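import Summits.HodgeConjecture.CorCM.CyclicSexticCMTypes
import HarnessLib

/-!
# CM types of a Galois SEXTIC CM field, II: the `SumTwo` dichotomy and the corner pattern of rank-four faces

HONEST FRAMING (cell `pub-hodgecm2` / COR-CM, seat b24 gen 8; COUNT-NEUTRAL — no binder row of
`HOME/BINDER-OWNERS.md` is touched, the E term and its binders are unchanged): the kernel form of FINDING F-6 (a)
of `HOME/pub-hodgecm2-lit-andre-3/PORTFOLIO-lit-andre-3.md` §3.1 and of the case split (P)/(F) of
`A1-BLUEPRINT.md` step L0, for EVERY Galois sextic CM field at once (the portfolio checked them by enumeration,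
`sextic_faces.py`).  Pure CM-type combinatorics: nothing about abelian varieties, Hodge classes or algebraic cycles
is asserted; no `sorry`, no named fact; axioms `propext`, `Classical.choice`, `Quot.sound`.

Let `K` be a CM number field, Galois over `ℚ`, `[K:ℚ] = 6`, and `σ ∈ Gal(K/ℚ)` of order `6` with `σ³ = ρ`
(complex conjugation; such `σ` exists and `Gal(K/ℚ) = ⟨σ⟩`, `CyclicSexticCMTypes.exists_generator`).  The
subgroup `⟨σ²⟩` of order `3` is `Gal(K/k)` for the imaginary quadratic subfield `k ⊂ K`; a CM type `Φ` with
`Φ ∘ σ² = Φ` (`cmTypeMap (σ²) Φ = Φ`) is the type INDUCED from `k` (degenerate; its abelian variety is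
`~ E³`, `E` the CM elliptic curve of `k`), the other six types are PRIMITIVE and form one orbit under twisting
(Dodson 1984 §5.1.3 Prop. 1, `n = 3`, `v = 1`: "`2³ = 2 + 6`").

* `type_dichotomy` (Dodson's `2³ = 2 + 6`): a CM type of `K` is `σ²`-stable or has three distinct twists `Φ, Φ∘σ², Φ∘σ⁴`.
* **`sumTwo_pattern`** (blueprint L0): four CM types `Ψ₀ … Ψ₃` with `Σⱼ 1_{Ψⱼ} ≡ 2` (`SumTwo`, the Hodge-type
  `(2,2)` condition of a Weil line on a product of four CM threefolds) are EITHER two complementary pairs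
  `{Ψ, Ψ̄} ⊔ {Ψ′, Ψ̄′}` (P) OR a face pattern (F): one `σ²`-stable type and the three distinct twists
  `Ψ, Ψ∘σ², Ψ∘σ⁴` of a primitive type `Ψ`.
* **`face_corner_pattern`** (FINDING F-6 (a)): for every rank-four face `f : Face K` (rfwf Def 1.1,
  `CorCM/CM/Basic.lean`) the four corners `f.corner` ARE a face pattern (F): up to order, one `k`-induced corner
  and the full `⟨σ²⟩`-orbit `{Ψ, Ψ∘σ², Ψ∘σ⁴}` of a primitive corner `Ψ` — so the face product is isogenous to
  `B × B × B × E³` with `B` the simple CM threefold of `K` carrying three twisted `K`-actions (portfolio §3.1 (a)).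

Method: the dictionary of part I (`ind6`: CM types ↦ antipodal vectors `Fin 6 → Bool`, faces ↦ `cornerB`) reduces
both statements to finite checks on `Bool³ × Fin 6` resp. `Bool¹²`, settled by `decide` (`cornerB_pattern`,
`sumTwoB_pattern`).

## References
* [Dodson1984] B. Dodson, *The structure of Galois groups of CM-fields*, Trans. AMS 283 (1984) 1–32, §5.1.2
  Theorem, §5.1.3 Prop. 1 (p. 20).
* rfwf v3 Def 1.1 / Lemma 1.2 (faces, corners, `Σ 1_{Φᵢ} = 2`) as typed in `CorCM/CM/Basic.lean`, `CorCM/CM/Lemmas.lean`.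
-/

noncomputable section

namespace Summit.HodgeConjecture.CorCM.CyclicSextic

open NumberField NumberField.ComplexEmbedding
open Literature.AlgebraicGeometry.Motives (CMType)
open Literature.NumberTheory.ComplexMultiplication (conjGal)
open Literature.NumberTheory.ComplexMultiplication.CMTypeOps
open Literature.NumberTheory.Automorphic.PicardCM.CMCode (cmTypeMap mem_cmTypeMap_iff)

variable {K : Type} [Field K] [NumberField K] [IsCMField K] [IsGalois ℚ K]

/-! ## 1. The finite checks -/

/-- **Combinatorial core** (the finite check behind FINDING F-6 (a)): for every antipodal indicator vector and every
second place `{b, b+3} ≠ {0, 3}`, the four corners consist of ONE vector stable under the shift by `2` and the full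
orbit `{C, C∘(+2), C∘(+4)}` of a vector `C` NOT stable under the shift by `2`. [folklore] -/
theorem cornerB_pattern :
    ∀ (x y z : Bool) (b : Fin 6), b ≠ 0 → b ≠ 3 →
      ∃ j₀ j₁ j₂ j₃ : Fin 4, [j₀, j₁, j₂, j₃].Nodup ∧
        shiftB 2 (cornerB (mkType x y z) b j₀) = cornerB (mkType x y z) b j₀ ∧
        (∀ j : Fin 4, j ≠ j₀ → shiftB 2 (cornerB (mkType x y z) b j) ≠ cornerB (mkType x y z) b j) ∧
        cornerB (mkType x y z) b j₂ = shiftB 2 (cornerB (mkType x y z) b j₁) ∧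
        cornerB (mkType x y z) b j₃ = shiftB 4 (cornerB (mkType x y z) b j₁) := by
  decide



/-- The orbit of an antipodal vector under the shift by `2` has size `1` or `3`. [folklore] -/
theorem shiftB_two_dichotomy :
    ∀ (x y z : Bool), shiftB 2 (mkType x y z) = mkType x y z ∨
      (shiftB 2 (mkType x y z) ≠ mkType x y z ∧ shiftB 4 (mkType x y z) ≠ mkType x y z ∧
        shiftB 2 (mkType x y z) ≠ shiftB 4 (mkType x y z)) := by
  decide

/-- **Combinatorial core for `SumTwo` quadruples**: four antipodal indicator vectors whose pointwise sum is `2`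
are either two complementary pairs (P) or a face pattern (F): one vector stable under the shift by `2` and the
full orbit of a non-stable one. [folklore] -/
theorem sumTwoB_pattern :
    ∀ (x₀ y₀ z₀ x₁ y₁ z₁ x₂ y₂ z₂ x₃ y₃ z₃ : Bool),
      (∀ i : Fin 6, (mkType x₀ y₀ z₀ i).toNat + (mkType x₁ y₁ z₁ i).toNat + (mkType x₂ y₂ z₂ i).toNat +
          (mkType x₃ y₃ z₃ i).toNat = 2) →
      (∃ j₁ j₂ j₃ : Fin 4, [0, j₁, j₂, j₃].Nodup ∧
          ![mkType x₀ y₀ z₀, mkType x₁ y₁ z₁, mkType x₂ y₂ z₂, mkType x₃ y₃ z₃] j₁ =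
            barB (![mkType x₀ y₀ z₀, mkType x₁ y₁ z₁, mkType x₂ y₂ z₂, mkType x₃ y₃ z₃] 0) ∧
          ![mkType x₀ y₀ z₀, mkType x₁ y₁ z₁, mkType x₂ y₂ z₂, mkType x₃ y₃ z₃] j₃ =
            barB (![mkType x₀ y₀ z₀, mkType x₁ y₁ z₁, mkType x₂ y₂ z₂, mkType x₃ y₃ z₃] j₂)) ∨
      (∃ j₀ j₁ j₂ j₃ : Fin 4, [j₀, j₁, j₂, j₃].Nodup ∧
          shiftB 2 (![mkType x₀ y₀ z₀, mkType x₁ y₁ z₁, mkType x₂ y₂ z₂, mkType x₃ y₃ z₃] j₀) =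
            ![mkType x₀ y₀ z₀, mkType x₁ y₁ z₁, mkType x₂ y₂ z₂, mkType x₃ y₃ z₃] j₀ ∧
          (∀ j : Fin 4, j ≠ j₀ → shiftB 2 (![mkType x₀ y₀ z₀, mkType x₁ y₁ z₁, mkType x₂ y₂ z₂, mkType x₃ y₃ z₃] j) ≠
            ![mkType x₀ y₀ z₀, mkType x₁ y₁ z₁, mkType x₂ y₂ z₂, mkType x₃ y₃ z₃] j) ∧
          ![mkType x₀ y₀ z₀, mkType x₁ y₁ z₁, mkType x₂ y₂ z₂, mkType x₃ y₃ z₃] j₂ =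
            shiftB 2 (![mkType x₀ y₀ z₀, mkType x₁ y₁ z₁, mkType x₂ y₂ z₂, mkType x₃ y₃ z₃] j₁) ∧
          ![mkType x₀ y₀ z₀, mkType x₁ y₁ z₁, mkType x₂ y₂ z₂, mkType x₃ y₃ z₃] j₃ =
            shiftB 4 (![mkType x₀ y₀ z₀, mkType x₁ y₁ z₁, mkType x₂ y₂ z₂, mkType x₃ y₃ z₃] j₁)) := by
  decide

/-- `sumTwoB_pattern` for an arbitrary family of four antipodal indicator vectors. [folklore] -/
theorem sumTwoB_pattern' (T : Fin 4 → Fin 6 → Bool) (hanti : ∀ j (i : Fin 6), T j (i + 3) = !T j i)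
    (hsum : ∀ i : Fin 6, (T 0 i).toNat + (T 1 i).toNat + (T 2 i).toNat + (T 3 i).toNat = 2) :
    (∃ j₁ j₂ j₃ : Fin 4, [0, j₁, j₂, j₃].Nodup ∧ T j₁ = barB (T 0) ∧ T j₃ = barB (T j₂)) ∨
    (∃ j₀ j₁ j₂ j₃ : Fin 4, [j₀, j₁, j₂, j₃].Nodup ∧
      shiftB 2 (T j₀) = T j₀ ∧ (∀ j, j ≠ j₀ → shiftB 2 (T j) ≠ T j) ∧ T j₂ = shiftB 2 (T j₁) ∧
      T j₃ = shiftB 4 (T j₁)) := by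
  have hT : ∀ j, T j = mkType (T j 0) (T j 1) (T j 2) := fun j => eq_mkType_of_antipodal _ (hanti j)
  have e : ![mkType (T 0 0) (T 0 1) (T 0 2), mkType (T 1 0) (T 1 1) (T 1 2),
      mkType (T 2 0) (T 2 1) (T 2 2), mkType (T 3 0) (T 3 1) (T 3 2)] = T := by
    funext j
    fin_cases j
    · exact (hT 0).symm
    · exact (hT 1).symm
    · exact (hT 2).symm
    · exact (hT 3).symm
  have hsum' : ∀ i : Fin 6, (mkType (T 0 0) (T 0 1) (T 0 2) i).toNat + (mkType (T 1 0) (T 1 1) (T 1 2) i).toNat +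
      (mkType (T 2 0) (T 2 1) (T 2 2) i).toNat + (mkType (T 3 0) (T 3 1) (T 3 2) i).toNat = 2 := by
    intro i
    rw [← hT 0, ← hT 1, ← hT 2, ← hT 3]
    exact hsum i
  have key := sumTwoB_pattern _ _ _ _ _ _ _ _ _ _ _ _ hsum'
  rw [e] at key
  exact key

/-! ## 2. The theorems on CM types and faces of a Galois sextic CM field -/

section Main

variable (σ : K ≃ₐ[ℚ] K) (p : K →+* ℂ)

omit [IsCMField K] [IsGalois ℚ K] in
/-- `ind6` of the twist by `σ²`. [folklore] -/
theorem ind6_cmTypeMap_two (hσ : orderOf σ = 6) (Φ : CMType K) :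
    ind6 σ p (cmTypeMap (σ ^ 2).toRingEquiv Φ) = shiftB 2 (ind6 σ p Φ) :=
  ind6_cmTypeMap σ p hσ Φ 2

omit [IsCMField K] [IsGalois ℚ K] in
/-- `ind6` of the twist by `σ⁴`. [folklore] -/
theorem ind6_cmTypeMap_four (hσ : orderOf σ = 6) (Φ : CMType K) :
    ind6 σ p (cmTypeMap (σ ^ 4).toRingEquiv Φ) = shiftB 4 (ind6 σ p Φ) :=
  ind6_cmTypeMap σ p hσ Φ 4

omit [IsCMField K] [IsGalois ℚ K] in
/-- `ind Φ (p ∘ σⁱ)` is the `ℤ`-cast of the indicator bit. [folklore] -/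
theorem ind_emb (Φ : CMType K) (i : Fin 6) : ind Φ (emb σ p i) = ((ind6 σ p Φ i).toNat : ℤ) := by
  by_cases hm : emb σ p i ∈ Φ.1
  · rw [ind_of_mem hm, show ind6 σ p Φ i = true from (ind6_eq_true_iff σ p Φ i).mpr hm]; rfl
  · rw [ind_of_not_mem hm, show ind6 σ p Φ i = false from
      Bool.eq_false_iff.mpr (fun h => hm ((ind6_eq_true_iff σ p Φ i).mp h))]; rfl

/-- **CM types of a Galois sextic CM field: the `SumTwo` dichotomy** (kernel form of the case split (P)/(F) of the
cell's A1 blueprint, step L0). Let `[K:ℚ] = 6`, `K` Galois and CM, `σ ∈ Gal(K/ℚ)` of order `6` with `σ³ = ρ`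
(`exists_generator`). If four CM types `Ψ₀,…,Ψ₃` satisfy `Σⱼ 1_{Ψⱼ} ≡ 2` (`SumTwo`), then EITHER they form two
complementary pairs `{Ψ, Ψ̄} ⊔ {Ψ′, Ψ̄′}` (P), OR (F) one of them is stable under the twist by `σ²` (i.e. under
`Gal(K/k)`, `k` the imaginary quadratic subfield: it is induced from `k`) and the other three are the three
distinct twists `Ψ, Ψ∘σ², Ψ∘σ⁴` of a type `Ψ` that is not `σ²`-stable (primitive). [folklore] -/
theorem sumTwo_pattern (h6 : Module.finrank ℚ K = 6) (hσ : orderOf σ = 6) (h3 : σ ^ 3 = conjGal)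
    (Ψ : Fin 4 → CMType K) (hΨ : SumTwo Ψ) :
    (∃ j₁ j₂ j₃ : Fin 4, [0, j₁, j₂, j₃].Nodup ∧ Ψ j₁ = bar (Ψ 0) ∧ Ψ j₃ = bar (Ψ j₂)) ∨
    (∃ j₀ j₁ j₂ j₃ : Fin 4, [j₀, j₁, j₂, j₃].Nodup ∧
      cmTypeMap (σ ^ 2).toRingEquiv (Ψ j₀) = Ψ j₀ ∧
      (∀ j, j ≠ j₀ → cmTypeMap (σ ^ 2).toRingEquiv (Ψ j) ≠ Ψ j) ∧
      Ψ j₂ = cmTypeMap (σ ^ 2).toRingEquiv (Ψ j₁) ∧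
      Ψ j₃ = cmTypeMap (σ ^ 4).toRingEquiv (Ψ j₁)) := by
  obtain ⟨p⟩ : Nonempty (K →+* ℂ) := inferInstance
  have hsum : ∀ i : Fin 6, (ind6 σ p (Ψ 0) i).toNat + (ind6 σ p (Ψ 1) i).toNat + (ind6 σ p (Ψ 2) i).toNat +
      (ind6 σ p (Ψ 3) i).toNat = 2 := by
    intro i
    have h := hΨ (emb σ p i)
    rw [ind_emb, ind_emb, ind_emb, ind_emb] at h
    exact_mod_cast h
  have key := sumTwoB_pattern' (fun j => ind6 σ p (Ψ j)) (fun j i => ind6_antipodal σ p hσ h3 (Ψ j) i) hsum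
  beta_reduce at key
  have hiff : ∀ Φ Φ' : CMType K, ind6 σ p Φ = ind6 σ p Φ' ↔ Φ = Φ' := ind6_eq_iff σ p h6 hσ
  rcases key with ⟨j₁, j₂, j₃, hnd, h1, h2⟩ | ⟨j₀, j₁, j₂, j₃, hnd, h0, h1, h2, h4⟩
  · refine Or.inl ⟨j₁, j₂, j₃, hnd, ?_, ?_⟩
    · rw [← hiff, ind6_bar]; exact h1
    · rw [← hiff, ind6_bar]; exact h2
  · refine Or.inr ⟨j₀, j₁, j₂, j₃, hnd, ?_, ?_, ?_, ?_⟩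
    · rw [← hiff, ind6_cmTypeMap_two σ p hσ]; exact h0
    · intro j hj h; exact h1 j hj (by rw [← ind6_cmTypeMap_two σ p hσ, h])
    · rw [← hiff, ind6_cmTypeMap_two σ p hσ]; exact h2
    · rw [← hiff, ind6_cmTypeMap_four σ p hσ]; exact h4

/-- **FINDING F-6 (a) in the kernel: the corner pattern of every rank-four face of a Galois sextic CM field.**
Let `[K:ℚ] = 6`, `K` Galois and CM, `σ ∈ Gal(K/ℚ)` of order `6` with `σ³ = ρ` (`exists_generator`). For every
rank-four face `f = (Φ; π, π′)` (`Face K`, rfwf Def 1.1) the four corners `Φ₁ … Φ₄` (`Face.corner`) are, up to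
order: ONE type `Φ_{j₀}` stable under the twist by `σ²` (stable under `Gal(K/k) = ⟨σ²⟩`, `k ⊂ K` the imaginary
quadratic subfield — the `k`-induced corner, realised by `E ⊗_{𝒪_k} 𝒪_K ~ E³`), and the THREE DISTINCT twists
`Ψ, Ψ∘σ², Ψ∘σ⁴` of a type `Ψ = Φ_{j₁}` that is not `σ²`-stable (primitive — the three twisted copies of the simple
CM threefold `B`). This is the statement checked by enumeration in `PORTFOLIO-lit-andre-3.md` §3.1 (a) /
`sextic_faces.py`, now for every Galois sextic CM field at once. [folklore] -/
theorem face_corner_pattern (h6 : Module.finrank ℚ K = 6) (hσ : orderOf σ = 6) (h3 : σ ^ 3 = conjGal)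
    (f : Face K) :
    ∃ j₀ j₁ j₂ j₃ : Fin 4, [j₀, j₁, j₂, j₃].Nodup ∧
      cmTypeMap (σ ^ 2).toRingEquiv (f.corner j₀) = f.corner j₀ ∧
      (∀ j, j ≠ j₀ → cmTypeMap (σ ^ 2).toRingEquiv (f.corner j) ≠ f.corner j) ∧
      f.corner j₂ = cmTypeMap (σ ^ 2).toRingEquiv (f.corner j₁) ∧
      f.corner j₃ = cmTypeMap (σ ^ 4).toRingEquiv (f.corner j₁) := by
  obtain ⟨b, hb⟩ := exists_emb_eq σ f.p h6 hσ f.p'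
  have hp0 : emb σ f.p ((0 : Fin 6) : ℕ) = f.p := emb_zero σ f.p
  have hb0 : b ≠ 0 := by
    rintro rfl
    exact f.place_ne (by rw [← hb, hp0])
  have hp3 : emb σ f.p ((3 : Fin 6) : ℕ) = conjugate f.p := by
    rw [show ((3 : Fin 6) : ℕ) = 0 + 3 from rfl, ← conjugate_emb σ f.p h3 0, emb_zero]
  have hb3 : b ≠ 3 := by
    rintro rfl
    refine f.place_ne ?_
    rw [← hb, hp3, InfinitePlace.mk_conjugate_eq]
  -- the indicator vector of `Φ` and of the four corners
  set χ := ind6 σ f.p f.Φ with hχdef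
  have hχ : χ = mkType (χ 0) (χ 1) (χ 2) := eq_mkType_of_antipodal χ (ind6_antipodal σ f.p hσ h3 f.Φ)
  have hC : ∀ j, ind6 σ f.p (f.corner j) = cornerB χ b j := by
    intro j
    match j with
    | 0 => rfl
    | 1 =>
      show ind6 σ f.p (flip f.p (bar f.Φ)) = flipB 0 (barB χ)
      have e : flip f.p (bar f.Φ) = flip (emb σ f.p ((0 : Fin 6) : ℕ)) (bar f.Φ) := by rw [hp0]
      rw [e, ind6_flip σ f.p hσ h3, ind6_bar]
    | 2 =>
      show ind6 σ f.p (flip f.p' (bar f.Φ)) = flipB b (barB χ)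
      rw [← hb, ind6_flip σ f.p hσ h3, ind6_bar]
    | 3 =>
      show ind6 σ f.p (flip f.p' (flip f.p f.Φ)) = flipB b (flipB 0 χ)
      have e : flip f.p' (flip f.p f.Φ) = flip (emb σ f.p b) (flip (emb σ f.p ((0 : Fin 6) : ℕ)) f.Φ) := by
        rw [hp0, hb]
      rw [e, ind6_flip σ f.p hσ h3, ind6_flip σ f.p hσ h3]
  obtain ⟨j₀, j₁, j₂, j₃, hnd, h0, h1, h2, h4⟩ := cornerB_pattern (χ 0) (χ 1) (χ 2) b hb0 hb3
  rw [← hχ] at h0 h1 h2 h4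
  have hiff : ∀ Φ Φ' : CMType K, ind6 σ f.p Φ = ind6 σ f.p Φ' ↔ Φ = Φ' := ind6_eq_iff σ f.p h6 hσ
  refine ⟨j₀, j₁, j₂, j₃, hnd, ?_, ?_, ?_, ?_⟩
  · rw [← hiff, ind6_cmTypeMap_two σ f.p hσ, hC]; exact h0
  · intro j hj h; exact h1 j hj (by rw [← hC, ← ind6_cmTypeMap_two σ f.p hσ, h])
  · rw [← hiff, ind6_cmTypeMap_two σ f.p hσ, hC, hC]; exact h2
  · rw [← hiff, ind6_cmTypeMap_four σ f.p hσ, hC, hC]; exact h4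

/-- **Dodson's `2³ = 2 + 6` for a Galois sextic CM field, orbit form**: a CM type of `K` is either stable under
the twist by `σ²` (induced from the imaginary quadratic subfield) or its three twists `Φ, Φ∘σ², Φ∘σ⁴` are
pairwise distinct (primitive type; the six primitive types form one orbit under all twists).
[cite: Dodson1984, §5.1.3 Prop. 1 (p. 20)] -/
theorem type_dichotomy (h6 : Module.finrank ℚ K = 6) (hσ : orderOf σ = 6) (h3 : σ ^ 3 = conjGal)
    (Φ : CMType K) :
    cmTypeMap (σ ^ 2).toRingEquiv Φ = Φ ∨
    (cmTypeMap (σ ^ 2).toRingEquiv Φ ≠ Φ ∧ cmTypeMap (σ ^ 4).toRingEquiv Φ ≠ Φ ∧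
      cmTypeMap (σ ^ 2).toRingEquiv Φ ≠ cmTypeMap (σ ^ 4).toRingEquiv Φ) := by
  obtain ⟨p⟩ : Nonempty (K →+* ℂ) := inferInstance
  have hiff : ∀ Φ Φ' : CMType K, ind6 σ p Φ = ind6 σ p Φ' ↔ Φ = Φ' := ind6_eq_iff σ p h6 hσ
  have hχ := eq_mkType_of_antipodal _ (ind6_antipodal σ p hσ h3 Φ)
  rcases shiftB_two_dichotomy (ind6 σ p Φ 0) (ind6 σ p Φ 1) (ind6 σ p Φ 2) with h | ⟨h1, h2, h12⟩
  · left
    rw [← hχ] at h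
    rw [← hiff, ind6_cmTypeMap_two σ p hσ]; exact h
  · right
    rw [← hχ] at h1 h2 h12
    refine ⟨fun h => h1 ?_, fun h => h2 ?_, fun h => h12 ?_⟩
    · rw [← ind6_cmTypeMap_two σ p hσ, h]
    · rw [← ind6_cmTypeMap_four σ p hσ, h]
    · rw [← ind6_cmTypeMap_two σ p hσ, ← ind6_cmTypeMap_four σ p hσ, h]

end Main

/-! ## 3. Glue: `SumTwo` is the slot count `#{j | s ∈ Ψ_j} = 2` of André's product form -/

section Glue

omit [NumberField K] [IsCMField K] [IsGalois ℚ K] in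
/-- `SumTwo Ψ` (`CorCM/CM/Basic.lean`) is the admissibility condition `#{j | s ∈ Ψ_j} = 2` for all `s` on a
family of four slot types, as it appears in André's product form at `p = 2`
(`AndreProductForm.mem_algebraicClasses_cmTypedProduct`, hypothesis `hW`, with `Ψ j = cmTypeMap (e j) (Φ (i j))`);
so `sumTwo_pattern` classifies exactly the admissible slot families of four CM threefolds of `K`. [folklore] -/
theorem sumTwo_iff_ncard_eq_two (Ψ : Fin 4 → CMType K) :
    SumTwo Ψ ↔ ∀ s : K →+* ℂ, {j : Fin 4 | s ∈ (Ψ j).1}.ncard = 2 := by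
  classical
  have key : ∀ s : K →+* ℂ, ind (Ψ 0) s + ind (Ψ 1) s + ind (Ψ 2) s + ind (Ψ 3) s =
      ((Finset.univ.filter fun j : Fin 4 => s ∈ (Ψ j).1).card : ℤ) := by
    intro s
    have h4 := Fin.sum_univ_four fun j => ind (Ψ j) s
    rw [← h4]
    have : ∀ j : Fin 4, ind (Ψ j) s = if s ∈ (Ψ j).1 then (1 : ℤ) else 0 := by
      intro j
      by_cases h : s ∈ (Ψ j).1
      · rw [ind_of_mem h, if_pos h]
      · rw [ind_of_not_mem h, if_neg h]
    simp only [this]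
    rw [Finset.sum_boole]
  have hset : ∀ s : K →+* ℂ,
      {j : Fin 4 | s ∈ (Ψ j).1} = ↑(Finset.univ.filter fun j : Fin 4 => s ∈ (Ψ j).1) := by
    intro s; ext j; simp
  constructor
  · intro h s
    rw [hset, Set.ncard_coe_finset]
    have := h s
    rw [key] at this
    exact_mod_cast this
  · intro h s
    show ind (Ψ 0) s + ind (Ψ 1) s + ind (Ψ 2) s + ind (Ψ 3) s = 2
    rw [key]
    have := h s
    rw [hset, Set.ncard_coe_finset] at this
    exact_mod_cast this

end Glue

end Summit.HodgeConjecture.CorCM.CyclicSextic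

end
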